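import Literature.NumberTheory.EllipticCurves.PeriodLatticeRationalityProofs
import Literature.NumberTheory.EllipticCurves.DeligneSerreProp27LevelDescentProofs
import Literature.NumberTheory.EllipticCurves.ManinConstantGamma1ModularDegree
import HarnessLib

/-!
# The Stevens lattice `Λ₁(f)` has rational Weierstrass invariants (granted a `Γ₁(N)`-presentation)
(route `ManinLocalTwoThree`, cruxes C2 stmt-BirchSwinnertonDyer-22967 / C3 stmt-BirchSwinnertonDyer-22968; cell bsd-f2-manin, prover p3 gen 21;
CES-discharge programme, stage 1 step (A3))

The tree proves (`PeriodLatticeRationalityProofs.ratCast_g₂_g₃_of_presentation`) that the `Γ₀(N)`-period lattice `Λ₀(f) = periodLattice f`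
of a nonzero weight-`2` cusp form `f` with rational coefficients has `g₂, g₃ ∈ ℚ`, by DESCENT ALONG `Aut(ℂ)`: conjugate a presentation
`℘_Λ(u)·G = F` by DIAMOND-INVARIANT cusp forms on `Γ₁(N)` (Deligne–Serre (2.7.2)), transport the differential identity, apply the
uniqueness theorem for the Weierstrass equation, and read off that every `Γ₀(N)`-period is a translation symmetry of the conjugate
lattice.  This file runs THE SAME ARGUMENT ON `Γ₁(N)`: the `Γ₁(N)`-period lattice `Λ₁(f) = periodLatticeGamma1 f` (Stevens 1989 §2: the
lattice of the `X₁(N)`-optimal curve up to the Manin constant `c₁`) has rational invariants as soon as `℘_{Λ₁}(u)` is presented as a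
quotient of ARBITRARY cusp forms on `Γ₁(N)` — diamond-invariance was only used to pass from `Γ₁(N)`- to `Γ₀(N)`-invariance of the quotient
`F'/G'`, and for `γ ∈ Γ₁(N)` slash-invariance is built into `CuspForm (Gamma1 N) k`.  Deligne–Serre (2.7.2) is the tree THEOREM
`DeligneSerre1974_span_integralLattice1_holds` (every level and weight), so no hypothesis of that kind remains.

* `apply_smul_eq_gamma1` — `F(γτ) = (cτ + d)^k F(τ)` for `F ∈ S_k(Γ₁(N))`, `γ ∈ Γ₁(N)`;
* `cuspSymbol_mem_of_eq_weierstrassP_gamma1` — periods `{∞, γ∞}_f`, `γ ∈ Γ₁(N)`, are translation symmetries of `℘_M` along `±u + c`;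
* `ratCast_g₂_g₃_of_gamma1_presentation` — **`g₂(L), g₃(L) ∈ ℚ` for a period pair `L` with `Λ(L) = Λ₁(f)`, granted a presentation
  `℘_L(u)·G = F`, `F, G ∈ S_k(Γ₁(N))`, `G ≠ 0`, `k ≥ 1`** (the presentation is supplied by the sibling `…StevensCurvePresentation`).

HONEST FRAMING: analytic lattice theory only; no named fact is used or introduced; CES / C2 / C3 / Manin's conjecture / BSD are NOT proved here.
[cite: Stevens1989, §2] [cite: Knapp1993, Thm. 11.74 (d)] [cite: AgasheRibetStein2006, §2] [cite: DeligneSerreASENS1974, Prop. 2.7 (2.7.2)]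
-/

set_option autoImplicit false
-- lint-debt: the directory name repeats the summit name (sibling precedent `ManinLocalTwoThreeCDivisionGamma1Core.lean`)
set_option linter.dupNamespace false

noncomputable section

open Complex Filter Topology Set Function
open UpperHalfPlane hiding I
open scoped Real Topology Manifold MatrixGroups PeriodPair ModularForm

open Literature.NumberTheory.EllipticCurves Literature.NumberTheory.EllipticCurves.ModularForms
open CongruenceSubgroup

namespace Summit.BirchSwinnertonDyer.BirchSwinnertonDyer.Theorems.ManinLocalTwoThree.StevensCurve

variable {N : ℕ} [NeZero N] {k : ℤ}

/-! ### `Γ₁(N)`-invariance of cusp forms on `Γ₁(N)` -/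

omit [NeZero N] in
/-- A `Γ₁(N)`-cusp form transforms under `γ ∈ Γ₁(N)`: `F(γτ) = (cτ + d)^k F(τ)` (slash-invariance). [folklore] -/
theorem apply_smul_eq_gamma1 (F : CuspForm (Gamma1 N) k) (γ : Gamma1 N) (τ : ℍ) :
    F ((γ : SL(2, ℤ)) • τ) = F τ * denom (γ : SL(2, ℤ)) τ ^ k := by
  have h2 : (⇑F : ℍ → ℂ) ∣[k] ((γ : SL(2, ℤ)) : GL (Fin 2) ℝ) = ⇑F :=
    SlashInvariantFormClass.slash_action_eq F _ (Subgroup.mem_map_of_mem (Matrix.SpecialLinearGroup.mapGL ℝ) γ.2)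
  have h3 := congrFun h2 τ
  rw [← ModularForm.SL_slash, ModularForm.SL_slash_apply] at h3
  have hd : denom (γ : SL(2, ℤ)) τ ≠ 0 := denom_ne_zero _ τ
  rw [← h3, mul_assoc, ← zpow_add₀ hd, neg_add_cancel, zpow_zero, mul_one]

/-! ### Periods over `Γ₁(N)` are translation symmetries -/

/-- **Periods over `Γ₁(N)` are translation symmetries.** Let `F', G' ∈ S_k(Γ₁(N))`, `M` a lattice, `ε = ±1`, `c ∈ ℂ`, and suppose
`F'(z)/G'(z) = ℘_M(εu(z) + c)` wherever `G'(z) ≠ 0` and `εu(z) + c ∉ M` (`u = 2πi∫f`, `f ≠ 0`). Then every period `{∞, γ∞}_f`,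
`γ ∈ Γ₁(N)`, lies in `M` (the `Γ₁(N)` twin of `cuspSymbol_mem_of_eq_weierstrassP`: `F'/G'` is `Γ₁(N)`-invariant by
`apply_smul_eq_gamma1`, `u(γτ) = u(τ) + {∞, γ∞}_f` by `eichlerIntegral_smul_sub_holds`, and
`PeriodPair.mem_lattice_of_weierstrassP_comp_add_eventuallyEq` concludes). [cite: Manin1972, Prop. 1.4] [cite: Stevens1989, §2] -/
theorem cuspSymbol_mem_of_eq_weierstrassP_gamma1 (f : CuspForm (Gamma0 N) 2) (hf : f ≠ 0) (M : PeriodPair)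
    (F' G' : CuspForm (Gamma1 N) k) (hG'0 : G' ≠ 0) {ε c : ℂ} (hε : ε = 1 ∨ ε = -1)
    (hglob : ∀ z : ℂ, 0 < z.im → (⇑G' ∘ ofComplex) z ≠ 0 →
      ε * eichlerIntegral f (ofComplex z) + c ∉ M.lattice →
        (⇑F' ∘ ofComplex) z / (⇑G' ∘ ofComplex) z = ℘[M] (ε * eichlerIntegral f (ofComplex z) + c))
    (γ : Gamma1 N) : cuspSymbol f ⟨(γ : SL(2, ℤ)), Gamma1_in_Gamma0 N γ.2⟩ ∈ M.lattice := by
  have hε0 : ε ≠ 0 := by rcases hε with rfl | rfl <;> norm_num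
  have hεsq : ε * ε = 1 := by rcases hε with rfl | rfl <;> norm_num
  set lam := cuspSymbol f ⟨(γ : SL(2, ℤ)), Gamma1_in_Gamma0 N γ.2⟩ with hlam
  set U : ℂ → ℂ := fun w ↦ eichlerIntegral f (ofComplex w) with hU
  have hG'1 := isCuspFunction_one_gamma1 G'
  -- a generic base point
  have hbad : (({z : ℂ | 0 < z.im} ∩ (⇑G' ∘ ofComplex) ⁻¹' {0}) ∪
      {z : ℂ | 0 < z.im ∧ ε * U z + c ∈ M.lattice} ∪
      {z : ℂ | 0 < z.im ∧ ε * (U z + lam) + c ∈ M.lattice}).Countable := by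
    refine ((countable_zeros_cuspForm G' hG'0).union ?_).union ?_
    · have hsub : {z : ℂ | 0 < z.im ∧ ε * U z + c ∈ M.lattice} ⊆
          ⋃ m ∈ (M.lattice : Set ℂ), ({z : ℂ | 0 < z.im} ∩ U ⁻¹' {ε * (m - c)}) := by
        rintro z ⟨hz, hm⟩
        simp only [mem_iUnion, mem_inter_iff, mem_setOf_eq, mem_preimage, mem_singleton_iff,
          SetLike.mem_coe, exists_prop]
        refine ⟨ε * U z + c, hm, hz, ?_⟩
        linear_combination (-(U z)) * hεsq
      exact (M.countable_lattice.biUnion fun m _ ↦ countable_fiber_eichlerIntegral f hf _).mono hsub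
    · have hsub : {z : ℂ | 0 < z.im ∧ ε * (U z + lam) + c ∈ M.lattice} ⊆
          ⋃ m ∈ (M.lattice : Set ℂ), ({z : ℂ | 0 < z.im} ∩ U ⁻¹' {ε * (m - c) - lam}) := by
        rintro z ⟨hz, hm⟩
        simp only [mem_iUnion, mem_inter_iff, mem_setOf_eq, mem_preimage, mem_singleton_iff,
          SetLike.mem_coe, exists_prop]
        refine ⟨ε * (U z + lam) + c, hm, hz, ?_⟩
        linear_combination (-(U z) - lam) * hεsq
      exact (M.countable_lattice.biUnion fun m _ ↦ countable_fiber_eichlerIntegral f hf _).mono hsub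
  obtain ⟨z₁, hz₁⟩ := nonempty_diff_of_countable hbad
  have hz₁im : 0 < z₁.im := hz₁.1
  simp only [Set.mem_sdiff, mem_union, mem_inter_iff, mem_preimage, mem_singleton_iff,
    mem_setOf_eq, not_or, not_and] at hz₁
  obtain ⟨⟨hz₁G, hz₁c⟩, hz₁lc⟩ := hz₁.2
  replace hz₁G : (⇑G' ∘ ofComplex) z₁ ≠ 0 := hz₁G hz₁im
  replace hz₁c : ε * U z₁ + c ∉ M.lattice := hz₁c hz₁im
  replace hz₁lc : ε * (U z₁ + lam) + c ∉ M.lattice := hz₁lc hz₁im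
  -- the identity near `z₁`
  have hΛo : IsOpen ((M.lattice : Set ℂ)ᶜ) := M.isClosed_lattice.isOpen_compl
  have hUc : ContinuousAt U z₁ := (analyticAt_eichlerIntegral_comp_ofComplex f hz₁im).continuousAt
  have hGc : ContinuousAt (⇑G' ∘ ofComplex) z₁ := (hG'1.analyticAt_comp_ofComplex hz₁im).continuousAt
  have ev0 : ∀ᶠ z in 𝓝 z₁, 0 < z.im := isOpen_upperHalfPlaneSet.mem_nhds hz₁im
  have ev1 : ∀ᶠ z in 𝓝 z₁, (⇑G' ∘ ofComplex) z ≠ 0 := hGc.eventually_ne hz₁G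
  have ev2 : ∀ᶠ z in 𝓝 z₁, ε * U z + c ∉ M.lattice :=
    ((continuous_const.mul continuous_id).add continuous_const).continuousAt.comp hUc
      |>.preimage_mem_nhds (hΛo.mem_nhds hz₁c)
  have ev3 : ∀ᶠ z in 𝓝 z₁, ε * (U z + lam) + c ∉ M.lattice :=
    ((continuous_const.mul (continuous_id.add continuous_const)).add continuous_const).continuousAt.comp
      hUc |>.preimage_mem_nhds (hΛo.mem_nhds hz₁lc)
  have hper : ∀ᶠ z in 𝓝 z₁, ℘[M] (ε * lam + (ε * U z + c)) = ℘[M] (ε * U z + c) := by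
    filter_upwards [ev0, ev1, ev2, ev3] with z h0 h1 h2 h3
    set τ : ℍ := ⟨z, h0⟩ with hτ
    have hτz : ofComplex z = τ := ofComplex_apply_of_im_pos h0
    -- the translate `γτ`
    set z' : ℂ := (((γ : SL(2, ℤ)) • τ : ℍ) : ℂ) with hz'
    have h0' : 0 < z'.im := ((γ : SL(2, ℤ)) • τ).im_pos
    have hτz' : ofComplex z' = (γ : SL(2, ℤ)) • τ := by
      rw [hz', ofComplex_apply]
    have hU' : U z' = U z + lam := by
      simp only [hU, hτz', hτz]
      have := eichlerIntegral_smul_sub_holds f ⟨(γ : SL(2, ℤ)), Gamma1_in_Gamma0 N γ.2⟩ τ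
      linear_combination this
    have hG'z : (G' : ℍ → ℂ) τ ≠ 0 := by simpa [comp_apply, hτz] using h1
    have h1' : (⇑G' ∘ ofComplex) z' ≠ 0 := by
      simp only [comp_apply, hτz', apply_smul_eq_gamma1 G' γ τ]
      exact mul_ne_zero hG'z (zpow_ne_zero _ (denom_ne_zero _ τ))
    have h3' : ε * U z' + c ∉ M.lattice := by rwa [hU']
    have hq := hglob z' h0' h1' h3'
    have hq0 := hglob z h0 h1 h2
    -- invariance of the quotient
    have hquot : (⇑F' ∘ ofComplex) z' / (⇑G' ∘ ofComplex) z' =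
        (⇑F' ∘ ofComplex) z / (⇑G' ∘ ofComplex) z := by
      simp only [comp_apply, hτz', hτz, apply_smul_eq_gamma1 F' γ τ, apply_smul_eq_gamma1 G' γ τ]
      rw [mul_div_mul_right _ _ (zpow_ne_zero _ (denom_ne_zero _ τ))]
    rw [show ε * lam + (ε * U z + c) = ε * U z' + c by rw [hU']; ring, ← hq, hquot, hq0]
  have hζ : AnalyticAt ℂ (fun z : ℂ ↦ ε * U z + c) z₁ :=
    (analyticAt_const.mul (analyticAt_eichlerIntegral_comp_ofComplex f hz₁im)).add analyticAt_const
  have hζnc : ¬ ∀ᶠ z in 𝓝 z₁, ε * U z + c = ε * U z₁ + c := by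
    intro h
    apply not_eventually_const_eichlerIntegral f hf hz₁im (U z₁)
    filter_upwards [h] with z hz
    have : ε * (U z - U z₁) = 0 := by linear_combination hz
    simpa [hε0, sub_eq_zero] using this
  have hmem := M.mem_lattice_of_weierstrassP_comp_add_eventuallyEq hζ hζnc hz₁c
    (by rw [show ε * lam + (ε * U z₁ + c) = ε * (U z₁ + lam) + c by ring]; exact hz₁lc) hper
  rcases hε with rfl | rfl
  · simpa using hmem
  · simpa using neg_mem hmem

/-! ### The main theorem: rational invariants of `Λ₁(f)` -/

/-- **Rational invariants of the Stevens lattice `Λ₁(f)`** (granted a `Γ₁(N)`-presentation). Let `f ∈ S₂(Γ₀(N))`, `f ≠ 0`, have rational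
Fourier coefficients, let `L` be a period pair with `Λ(L) = Λ₁(f)` (`periodLatticeGamma1 f`), and assume a presentation
`℘_Λ(u(τ))·G(τ) = F(τ)` (`u(τ) ∉ Λ`) with `F, G ∈ S_k(Γ₁(N))`, `G ≠ 0`, `k ≥ 1`. Then `g₂(L), g₃(L) ∈ ℚ` — the complex torus `ℂ/Λ₁(f)`
is an elliptic curve over `ℚ` (Stevens' `X₁(N)`-optimal curve up to its Manin constant; classically from the optimal quotient of `J₁(N)`,
Stevens 1989 §2 / Conrad–Edixhoven–Stein 2003 §6.1). Proof: descent along `Aut(ℂ)` exactly as `ratCast_g₂_g₃_of_presentation`, with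
Deligne–Serre (2.7.2) supplied by the THEOREM `DeligneSerre1974_span_integralLattice1_holds` and step A by
`cuspSymbol_mem_of_eq_weierstrassP_gamma1`. [cite: Stevens1989, §2] [cite: Knapp1993, Thm. 11.74 (d)] [cite: AgasheRibetStein2006, §2]
[cite: DeligneSerreASENS1974, Prop. 2.7 (2.7.2)] -/
theorem ratCast_g₂_g₃_of_gamma1_presentation (f : CuspForm (Gamma0 N) 2) (hf : f ≠ 0)
    (hrat : ∀ n, ∃ q : ℚ, (q : ℂ) = cuspCoeff f n) (L : PeriodPair)
    (hL : ∀ x, x ∈ L.lattice ↔ x ∈ periodLatticeGamma1 f)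
    (hpres : ∃ (k : ℤ) (F G : CuspForm (Gamma1 N) k), 1 ≤ k ∧ G ≠ 0 ∧
      ∀ τ : ℍ, eichlerIntegral f τ ∉ L.lattice → ℘[L] (eichlerIntegral f τ) * G τ = F τ) :
    (∃ q : ℚ, (q : ℂ) = L.g₂) ∧ (∃ q : ℚ, (q : ℂ) = L.g₃) := by
  refine L.ratCast_g₂_g₃_of_forall_le fun σ M hM₂ hM₃ ↦ ?_
  obtain ⟨k, F, G, hk, hG0, hFG⟩ := hpres
  have hspan := DeligneSerre1974_span_integralLattice1_holds N k hk
  obtain ⟨F', hF'c, -⟩ := exists_cuspForm_conj hspan σ F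
  obtain ⟨G', hG'c, -⟩ := exists_cuspForm_conj hspan σ G
  have hG'0 : G' ≠ 0 := ne_zero_of_conj hG'c hG0
  have hF'1 := isCuspFunction_one_gamma1 F'
  have hG'1 := isCuspFunction_one_gamma1 G'
  -- the transported differential identity and the equation for `h = F'/G'`
  have hode0 := odeFun_eq_zero_of_presentation f hf L F G hFG
  have hode1 := odeFun_conj_eq_zero f hrat σ hF'c hG'c L.g₂ L.g₃ hode0
  rw [← hM₂, ← hM₃] at hode1
  set V : Set ℂ := {z : ℂ | 0 < z.im ∧ (⇑G' ∘ ofComplex) z ≠ 0} with hV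
  have hVo : IsOpen V := hG'1.differentiableOn_comp_ofComplex.continuousOn.isOpen_inter_preimage
    isOpen_upperHalfPlaneSet isOpen_compl_singleton
  have hVC : V ⊆ {z : ℂ | 0 < z.im} := fun z hz ↦ hz.1
  have hcount : ({z : ℂ | 0 < z.im} \ V).Countable := by
    refine (countable_zeros_cuspForm G' hG'0).mono ?_
    rintro z ⟨hz, hzV⟩
    exact ⟨hz, by by_contra h; exact hzV ⟨hz, h⟩⟩
  have hwan : AnalyticOnNhd ℂ (fun z : ℂ ↦ (⇑F' ∘ ofComplex) z / (⇑G' ∘ ofComplex) z) V :=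
    fun z hz ↦ (hF'1.analyticAt_comp_ofComplex hz.1).div (hG'1.analyticAt_comp_ofComplex hz.1) hz.2
  have hvan : AnalyticOnNhd ℂ (fun z : ℂ ↦ eichlerIntegral f (ofComplex z)) V :=
    fun z hz ↦ analyticAt_eichlerIntegral_comp_ofComplex f hz.1
  have hode : ∀ z ∈ V, deriv (fun w : ℂ ↦ (⇑F' ∘ ofComplex) w / (⇑G' ∘ ofComplex) w) z ^ 2 =
      deriv (fun w : ℂ ↦ eichlerIntegral f (ofComplex w)) z ^ 2 *
        (4 * ((⇑F' ∘ ofComplex) z / (⇑G' ∘ ofComplex) z) ^ 3 -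
          M.g₂ * ((⇑F' ∘ ofComplex) z / (⇑G' ∘ ofComplex) z) - M.g₃) :=
    fun z hz ↦ deriv_div_sq_of_odeFun_eq_zero f F' G' M.g₂ M.g₃ hode1 hz.1 hz.2
  obtain ⟨z₀, hz₀im, hz₀G, h0⟩ := exists_nondegenerate_of_conj f hf L σ hF'c hG'c hG0 hFG M.g₂ M.g₃
  -- the uniqueness theorem for the Weierstrass equation
  obtain ⟨ε, hε, c, -, hglob⟩ := M.exists_eq_weierstrassP_of_deriv_sq convex_setOf_im_pos
    isOpen_upperHalfPlaneSet hVo hVC hcount hwan hvan hode ⟨hz₀im, hz₀G⟩ h0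
  -- every `Γ₁(N)`-period lies in `M`
  have hper : ∀ γ : Gamma1 N, cuspSymbol f ⟨(γ : SL(2, ℤ)), Gamma1_in_Gamma0 N γ.2⟩ ∈ M.lattice :=
    cuspSymbol_mem_of_eq_weierstrassP_gamma1 f hf M F' G' hG'0 hε
      (fun z hz hGz hc ↦ hglob z ⟨hz, hGz⟩ hc)
  have hsub : periodLatticeGamma1 f ≤ M.lattice.toAddSubgroup := by
    rw [periodLatticeGamma1, AddSubgroup.closure_le]
    rintro _ ⟨γ, rfl⟩
    exact hper γ
  intro x hx
  exact hsub ((hL x).mp hx)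

end Summit.BirchSwinnertonDyer.BirchSwinnertonDyer.Theorems.ManinLocalTwoThree.StevensCurve

end
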